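import Literature.Computability.Complexity.OrbitDeciders
import Literature.Computability.Complexity.FPStepper
import Literature.Computability.Complexity.SpaceTMSATHard
import HarnessLib

/-!
# Every `PSPACE` language has an orbit decider and an `FP` stepper; `P^PSPACE ⊆ PSPACE`

Assembly file on top of three trunk toolkits:

* `OrbitDeciders.lean` — `OrbitDecider A`: an `FP` round function `F` iterated `2^{|Nu w|}` times
  on polynomially short states from `ι w` decides `A` (`OrbitDecider.mem_PSPACE`: `A ∈ PSPACE`);
* `SpaceTMSAT.lean` / `SpaceTMSATHard.lean` — the bounded-halting language `SPACETMSAT` of flat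
  programs has an orbit decider (`SpaceTMSAT.decider`) and is `PSPACE`-hard
  (`isHard_PSPACE_SPACETMSAT`; Arora–Barak 2009, §4.2, `SPACE TMSAT`; Homer–Selman 2011, §7.5.1,
  `𝒰_PS`);
* `FPStepper.lean` — `FPStepper A`: the decider of `A` as an iteration of polynomial-time string
  maps (`initFn`, `stepFn`, `haltFn`, `ansFn`) with polynomially short codes, and
  `Stepper.PRel_subset_PSPACE`: `P^A ⊆ PSPACE` for every `A` with an `FP` stepper (each query is
  answered by running the stepper in place; Hirahara–Lu–Ren 2023, Rem. 2; Homer–Selman 2011,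
  proof of Prop. 7.5 / Thm. 7.18).

Results:

* `OrbitDecider.iterate_roundS_initS` — the iteration of the round function `roundS` of the loop
  of an orbit decider from its initial state `initS y` walks through the states `stateAt y k`,
  frozen at round `2^{|Nu y|}`;
* `OrbitDecider.toFPStepper` — **an orbit decider is an `FP` stepper** (codes = loop states,
  step = `roundS`, halting bit = the flag, answer bit = the head symbol);
* `orbitDecider_of_mem_PSPACE` — **every `A ∈ PSPACE` has an orbit decider** (pull back the orbit
  decider of `SPACETMSAT` along the Karp reduction given by hardness), hence an `FP` stepper
  (`fpStepper_of_mem_PSPACE`); `mem_PSPACE_iff_nonempty_orbitDecider`;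
* `PRel_subset_PSPACE_of_mem_PSPACE_holds` — **discharge of the named fact
  `PRel_subset_PSPACE_of_mem_PSPACE`** of `SpaceOracles.lean` (F3: `P^A ⊆ PSPACE` for every
  `A ∈ PSPACE`).

## References

* S. Hirahara, Z. Lu, H. Ren, *Bounded relativization*, CCC 2023, LIPIcs 264, Rem. 2 (p. 3:
  "PSPACE^PSPACE = PSPACE"). [HiraharaLuRen2023]
* S. Homer, A. L. Selman, *Computability and Complexity Theory*, 2nd ed., Springer 2011, proof of
  Prop. 7.5 (`NP^PSPACE = PSPACE`) and Thm. 7.18; §7.5.1 (`𝒰_PS`, Homework 7.13). [HomerSelman2011]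
* S. Arora, B. Barak, *Computational Complexity: A Modern Approach*, CUP 2009, Thm. 4.2 and §4.1
  (space-bounded iteration, reuse of space), §4.2 (eq. (4.3), `SPACE TMSAT`; Def. 4.9).
  [AroraBarakCC2009]
-/

noncomputable section

namespace Literature.Computability.Complexity

open _root_.Computability Polynomial Brick

namespace OrbitDecider

variable {A : Language Bool} (D : OrbitDecider A)

/-- **The iterated round function of the loop**: from the initial state of `y`, `j` rounds of
`roundS` reach the state `stateAt y (min j 2^{|Nu y|})` — the states advance up to round
`2^{|Nu y|}`, where the flag is raised and `roundS` is the identity. [cite: AroraBarakCC2009, §4.1 (reuse of space)] -/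
theorem iterate_roundS_initS (y : List Bool) (j : ℕ) :
    D.roundS^[j] (D.initS y) = D.stateAt y (min j (2 ^ (D.Nu y).length)) := by
  induction j with
  | zero =>
    rw [Function.iterate_zero, id_eq, initS_apply, Nat.zero_min, stateAt]
    simp only [Function.iterate_zero, id_eq, Nat.le_zero]
    rw [decide_eq_false (Nat.pos_iff_ne_zero.1 (Nat.two_pow_pos _))]
    rfl
  | succ j ih =>
    rw [Function.iterate_succ_apply', ih]
    by_cases hj : j < 2 ^ (D.Nu y).length
    · rw [Nat.min_eq_left hj.le, roundS_stateAt D y hj, Nat.min_eq_left hj]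
    · replace hj := Nat.le_of_not_lt hj
      rw [Nat.min_eq_right hj, Nat.min_eq_right (Nat.le_succ_of_le hj), roundS, stateAt,
        decide_eq_true le_rfl, iteFn_apply_true (take1Fn_mkS _ _ _ _ _ _), id]

/-- The states of the loop have length `≤ 2|y| + 5 s(|y|) + 10` up to round `2^{|Nu y|}`.
[cite: AroraBarakCC2009, §4.1] -/
theorem length_stateAt_le (y : List Bool) {k : ℕ} (hk : k ≤ 2 ^ (D.Nu y).length) :
    (D.stateAt y k).length ≤ (2 * X + 5 * D.s + 10 : Polynomial ℕ).eval y.length := by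
  rw [stateAt, length_mkS]
  have h1 := D.Nu_le y
  have h2 := D.size_le y k
  have h3 : (encodeNat k).length ≤ (D.Nu y).length + 1 := by
    rw [TM2Pass.length_encodeNat_eq_size, Nat.size_le]
    calc k ≤ 2 ^ (D.Nu y).length := hk
      _ < 2 ^ ((D.Nu y).length + 1) := Nat.pow_lt_pow_right (by norm_num) (Nat.lt_succ_self _)
  simp only [eval_add, eval_mul, eval_ofNat, eval_X]
  omega

/-- The answer accessor `take1Fn ∘ tail` reads the answer bit of a state. [folklore] -/
theorem take1Fn_tail_mkS (f a : Bool) (x u c st : List Bool) :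
    (take1Fn ∘ List.tail) (mkS f a x u c st) = [a] := rfl

/-- The head symbol of the final orbit state is the indicator bit of `A` (`correct`, as a Boolean
identity). [folklore] -/
theorem headI_final_eq (y : List Bool) :
    (D.F^[2 ^ (D.Nu y).length] (D.ι y)).headI = A.boolIndicator y := by
  rcases Bool.eq_false_or_eq_true (A.boolIndicator y) with hb | hb
  · rw [hb]; exact (D.correct y).2 ((Set.mem_iff_boolIndicator _ _).2 hb)
  · rw [hb]
    cases hh : (D.F^[2 ^ (D.Nu y).length] (D.ι y)).headI
    · rfl
    · exact absurd ((Set.mem_iff_boolIndicator _ _).1 ((D.correct y).1 hh)) (by rw [hb]; simp)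

/-- **An orbit decider is an `FP` stepper.** The codes are the states
`f a ⟨y, ⟨Nu y, ⟨c, st⟩⟩⟩` of the loop of `OrbitDecider.mem_PSPACE` (flag, answer bit, query,
unary budget, binary round counter, orbit state), the step is one round `roundS` (advance the
orbit and the counter; freeze once the counter reaches `2^{|Nu y|}`), the halting bit is the flag
and the answer bit is the head symbol of the orbit state, correct at the frozen round by
`correct`. [cite: HomerSelman2011, proof of Prop. 7.5 and Thm. 7.18 (run the space-bounded decider of the oracle in place)] [cite: AroraBarakCC2009, §4.1] -/
def toFPStepper : FPStepper A where
  initFn := D.initS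
  stepFn := D.roundS
  haltFn := take1Fn
  ansFn := take1Fn ∘ List.tail
  initFn_mem := D.initS_mem_FP
  stepFn_mem := D.roundS_mem_FP
  haltFn_mem := take1Fn_mem_FP
  ansFn_mem := comp_mem_FP take1Fn_mem_FP PRelSigma.tail_mem_FP
  bound := 2 * X + 5 * D.s + 10
  length_le y j := by
    rw [iterate_roundS_initS]
    exact D.length_stateAt_le y (Nat.min_le_right _ _)
  haltFn_bit y j := ⟨_, by rw [iterate_roundS_initS, stateAt, take1Fn_mkS]⟩
  halts y := ⟨2 ^ (D.Nu y).length, by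
    rw [iterate_roundS_initS, Nat.min_self, stateAt, take1Fn_mkS, decide_eq_true le_rfl]⟩
  ansFn_eq y j h := by
    rw [iterate_roundS_initS, stateAt, take1Fn_mkS] at h
    have hk : 2 ^ (D.Nu y).length ≤ min j (2 ^ (D.Nu y).length) :=
      of_decide_eq_true (List.cons.inj h).1
    rw [iterate_roundS_initS, le_antisymm (Nat.min_le_right _ _) hk, stateAt, take1Fn_tail_mkS,
      headI_final_eq]

end OrbitDecider

/-! ### Every `PSPACE` language has an orbit decider -/

/-- **Every `A ∈ PSPACE` has an orbit decider**: `A ≤ₚ SPACETMSAT` by `PSPACE`-hardness of the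
bounded-halting language of flat programs, and orbit deciders pull back along Karp reductions.
[cite: AroraBarakCC2009, §4.2 (eq. (4.3), Exercise 4.2; Def. 4.9)] [cite: HomerSelman2011, §7.5.1 (Homework 7.13)] -/
def orbitDecider_of_mem_PSPACE {A : Language Bool} (hA : A ∈ PSPACE) : OrbitDecider A :=
  SpaceTMSAT.decider.ofKarpReducible (isHard_PSPACE_SPACETMSAT A hA)

/-- **`PSPACE` is exactly the class of orbit-decided languages.** [cite: AroraBarakCC2009, Thm. 4.2, §4.1 and §4.2] -/
theorem mem_PSPACE_iff_nonempty_orbitDecider (A : Language Bool) :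
    A ∈ PSPACE ↔ Nonempty (OrbitDecider A) :=
  ⟨fun hA => ⟨orbitDecider_of_mem_PSPACE hA⟩, fun ⟨D⟩ => D.mem_PSPACE⟩

/-- **Every `A ∈ PSPACE` has an `FP` stepper.** [cite: HomerSelman2011, proof of Prop. 7.5 and Thm. 7.18] -/
def fpStepper_of_mem_PSPACE {A : Language Bool} (hA : A ∈ PSPACE) : FPStepper A :=
  (orbitDecider_of_mem_PSPACE hA).toFPStepper

/-! ### Discharge of F3 -/

/-- **Discharge of the named fact `PRel_subset_PSPACE_of_mem_PSPACE`** (`SpaceOracles.lean`, F3):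
`P^A ⊆ PSPACE` for every `A ∈ PSPACE` — the `FP` stepper of `A` fed to
`Stepper.PRel_subset_PSPACE`. [cite: HiraharaLuRen2023, Rem. 2 (p. 3: PSPACE^PSPACE = PSPACE)] [cite: HomerSelman2011, proof of Prop. 7.5 and Thm. 7.18] -/
theorem PRel_subset_PSPACE_of_mem_PSPACE_holds : PRel_subset_PSPACE_of_mem_PSPACE :=
  fun _ hA => Stepper.PRel_subset_PSPACE (fpStepper_of_mem_PSPACE hA)

end Literature.Computability.Complexity

end
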